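import Summits.QuantumFields.BalabanUV.T4Continuum.Support.LineAveragingPairing
import Summits.QuantumFields.BalabanUV.T4Continuum.Support.CovariantBlockAveraging

/-!
# T⁴ programme, spine node NE2 (U1a), tier B row B3.b-conc (ii) — NESTED-CONTOUR TRANSPORT, file 1: a REFINED straight leg against
# its PARENT leg (`leg_two_level`): groups of `L` fine bonds sharing one parent coarse bond, telescoped

NE2 formalisation swarm `b2b-balaban-t4-ne2-formalise-*`, seat leaf-06, row B3.b-conc of `t4/formal/NE2/LEAVES.md` (the «nested-contour
bookkeeping», skeleton `t4/SKELETON-NE2-P1.md` §3 «HARD: B3.b»), split with leaf-07 (journal l.5680 (3) / l.6068): (ii) TRANSPORTER LEVEL =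
this lineage (files `NestedContourTransport` + `NestedContourTransportContour`), (iii) averaging level = leaf-07's `opNorm_Ecov_pairing_le`,
which takes the END theorem of file 2 (`transport_contour_two_level`) as its hypothesis `hT2`.  Objects are leaf-07's (`Support/CovariantBlock
Averaging`, imported BY NAME): `transport Nf R μ Γ` (ordered bond product read in colour slot `μ`), `leg`, `corner`, `contour` ((1.7) legs then
the (1.18) line), and file `Support/LineAveragingPairing`'s `glue` / `par_bpt_glue_add_tstep` (the block parent of a refined-contour point).

 * §1 list algebra over `Matrix o o ℂ` (no commutativity, no unitarity): `norm_prod_le_pow`, **`norm_prod_sub_prod_le`** (two products of equal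
   length with factors of norm `≤ B`: `‖Πl₁ − Πl₂‖ ≤ B^{ℓ}·Σ_i‖l₁[i] − l₂[i]‖`), **`norm_prod_sub_one_sub_sum_le`** (a product of near-identity
   factors is linear to second order: `≤ (1 + a)^ℓ − 1 − ℓa`), **`norm_prod_sub_single_le`** (a GROUP of `ℓ` fine factors against ONE coarse
   factor whose «connection» is `ℓ` times theirs: `≤ ((1 + a)^ℓ − 1 − ℓa) + ℓb`);
 * §2 legs: `leg_add` (concatenation), **`leg_mul`** (a leg of `L·m` bonds = `m` consecutive groups of `L`), `transport_flatMap`, `transport_leg`,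
   `norm_transport_leg_le`;
 * §3 **`leg_two_level`**: for bond transporters `R′` (spacing `(Ln)⁻¹`, `‖R′ − 1‖ ≤ a′`) and `R` (spacing `n⁻¹`, `‖R − 1‖ ≤ a`) with the
   PER-BOND CONNECTION CONSISTENCY `‖(R′_ν(x′) − 1) − L⁻¹(R_ν(par x′) − 1)‖ ≤ b` (the `LipschitzBackgroundM.consistent` shape divided by `L·n`)
   and a PHASE-ALIGNED pair of starting points (`par(z′ + s e_ν) = z + ⌊s/L⌋e_ν` for all `s`), the fine leg of `L·m + e` bonds (`e ≤ L`
   trailing) and the coarse leg of `m` bonds have transporters within `Bc^{m+1}·(m·γ + ξ)`, `Bc = (1 + a′)^L(1 + a)`, `γ = ((1 + a′)^L − 1 − La′)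
   + Lb`, `ξ = (1 + a′)^L − 1`.

HONEST FRAMING (T4-DAG p. 1).  MODEL LEVEL: bond transporters at two adjacent spacings are DATA with size and per-bond consistency hypotheses
(the consistency is NE3's currency, row B6 `Support/NE2FromNE3`, consumed as a hypothesis SHAPE — nothing of NE3 is proved or assumed here);
finite torus; exact list/lattice bookkeeping plus the triangle inequality; statements and constants OURS ([folklore]); the `[cite:]` tags locate
the printed OBJECTS ((1.6)–(1.7), (1.18) of [Balaban1984PropagatorsI], (3.19) of [Balaban1985BackgroundPropagators]).  ONE input (ii) of row
B3.b-conc of the NE2 skeleton; NOT [B9] (3.19)/(3.26) as printed, NOT NE2, no B0; NOT infinite volume, NOT a mass gap, NOT Clay, NOT summit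
progress; spine 0/9 unchanged.  HONEST DEPENDENCY: continuum YM on T⁴ ⇐ BetaPertH ∧ nine spine estimates (0/9 proved); BetaPertH ⇐ (D1) ∧
(D4) ∧ CAP+tail; G-an2-4 gates asym, D1 and NE2/3/4.  ABSOLUTE RULE kept; no `sorry`.
-/

noncomputable section

open scoped BigOperators ComplexConjugate Matrix Matrix.Norms.L2Operator
open Finset

namespace Summit.QuantumFields.BalabanUV.T4Continuum.NestedContourTransport

open Literature.MathematicalPhysics.QuantumFieldTheory.Balaban1983to89.B5Prop11Plancherel
open Literature.MathematicalPhysics.QuantumFieldTheory.Balaban1983to89.B5Block118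
open Literature.MathematicalPhysics.QuantumFieldTheory.Balaban1983to89.B5G183RateTorus (opNorm_le_of_offDiag_eq_zero)
open Summit.QuantumFields.BalabanUV.T4Continuum.BalabanAveragedTowerModes (par)
open Summit.QuantumFields.BalabanUV.T4Continuum.CovariantBlockAveraging (transport transport_append leg length_leg
  norm_listProd_sub_one_le norm_transport_sub_one_le pow_sub_one_mono)

variable {d : ℕ}

/-! ## §1 List algebra: products of near-identity matrices -/

section ListAlgebra

variable {o : Type*} [Fintype o] [DecidableEq o]

/-- `‖1‖ ≤ 1` for the `ℓ²` operator norm (also when `o` is empty). [folklore] -/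
theorem opNorm_one_le' : ‖(1 : Matrix o o ℂ)‖ ≤ 1 :=
  opNorm_le_of_offDiag_eq_zero _ zero_le_one (fun _ _ hij => Matrix.one_apply_ne hij) fun i => by
    rw [Matrix.one_apply_eq]; simp

/-- a product of matrices of norm `≤ B` (`B ≥ 1`) has norm `≤ B^{length}`. [folklore] -/
theorem norm_prod_le_pow (l : List (Matrix o o ℂ)) {B : ℝ} (hB : 1 ≤ B) (h : ∀ X ∈ l, ‖X‖ ≤ B) : ‖l.prod‖ ≤ B ^ l.length := by
  induction l with
  | nil => simpa using opNorm_one_le' (o := o)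
  | cons X l ih =>
    rw [List.prod_cons, List.length_cons, pow_succ, mul_comm]
    exact (Matrix.l2_opNorm_mul _ _).trans (mul_le_mul (h X List.mem_cons_self)
      (ih fun Y hY => h Y (List.mem_cons_of_mem X hY)) (norm_nonneg _) (zero_le_one.trans hB))

/-- near-identity factors: `‖X − 1‖ ≤ a ⇒ ‖X‖ ≤ 1 + a`. [folklore] -/
theorem norm_le_one_add {X : Matrix o o ℂ} {a : ℝ} (h : ‖X - 1‖ ≤ a) : ‖X‖ ≤ 1 + a := by
  calc ‖X‖ = ‖(X - 1) + 1‖ := by rw [sub_add_cancel]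
    _ ≤ ‖X - 1‖ + ‖(1 : Matrix o o ℂ)‖ := norm_add_le _ _
    _ ≤ a + 1 := add_le_add h opNorm_one_le'
    _ = 1 + a := add_comm _ _

/-- **TELESCOPING OF TWO PRODUCTS**: for two lists of the same length whose entries all have norm `≤ B` (`B ≥ 1`),
`‖Π l₁ − Π l₂‖ ≤ B^{length} · Σ_i ‖l₁[i] − l₂[i]‖`. [folklore] -/
theorem norm_prod_sub_prod_le (l₁ l₂ : List (Matrix o o ℂ)) (hlen : l₁.length = l₂.length) {B : ℝ} (hB : 1 ≤ B)
    (h₁ : ∀ X ∈ l₁, ‖X‖ ≤ B) (h₂ : ∀ X ∈ l₂, ‖X‖ ≤ B) :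
    ‖l₁.prod - l₂.prod‖ ≤ B ^ l₁.length * (List.zipWith (fun X Y => ‖X - Y‖) l₁ l₂).sum := by
  induction l₁ generalizing l₂ with
  | nil =>
    cases l₂ with
    | nil => simp
    | cons Y m => simp at hlen
  | cons X l ih =>
    cases l₂ with
    | nil => simp at hlen
    | cons Y m =>
      have hlen' : l.length = m.length := by simpa using hlen
      have hX : ‖X‖ ≤ B := h₁ X List.mem_cons_self
      have hY : ‖Y‖ ≤ B := h₂ Y List.mem_cons_self
      have hl : ∀ Z ∈ l, ‖Z‖ ≤ B := fun Z hZ => h₁ Z (List.mem_cons_of_mem X hZ)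
      have hm : ∀ Z ∈ m, ‖Z‖ ≤ B := fun Z hZ => h₂ Z (List.mem_cons_of_mem Y hZ)
      have ihm := ih m hlen' hl hm
      have hB0 : 0 ≤ B := zero_le_one.trans hB
      have hPl : ‖l.prod‖ ≤ B ^ l.length := norm_prod_le_pow l hB hl
      rw [List.prod_cons, List.prod_cons, List.length_cons, List.zipWith_cons_cons, List.sum_cons]
      have e : X * l.prod - Y * m.prod = (X - Y) * l.prod + Y * (l.prod - m.prod) := by noncomm_ring
      rw [e]
      calc ‖(X - Y) * l.prod + Y * (l.prod - m.prod)‖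
          ≤ ‖X - Y‖ * ‖l.prod‖ + ‖Y‖ * ‖l.prod - m.prod‖ :=
            (norm_add_le _ _).trans (add_le_add (Matrix.l2_opNorm_mul _ _) (Matrix.l2_opNorm_mul _ _))
        _ ≤ ‖X - Y‖ * B ^ l.length + B * (B ^ l.length * (List.zipWith (fun X Y => ‖X - Y‖) l m).sum) :=
            add_le_add (mul_le_mul_of_nonneg_left hPl (norm_nonneg _)) (mul_le_mul hY ihm (norm_nonneg _) hB0)
        _ ≤ B ^ (l.length + 1) * (‖X - Y‖ + (List.zipWith (fun X Y => ‖X - Y‖) l m).sum) := by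
            have h1 : ‖X - Y‖ * B ^ l.length ≤ B ^ l.length * B * ‖X - Y‖ := by
              rw [mul_comm]
              exact mul_le_mul_of_nonneg_right (le_mul_of_one_le_right (pow_nonneg hB0 _) hB) (norm_nonneg _)
            have h2 : B * (B ^ l.length * (List.zipWith (fun X Y => ‖X - Y‖) l m).sum)
                = B ^ l.length * B * (List.zipWith (fun X Y => ‖X - Y‖) l m).sum := by ring
            rw [pow_succ, h2, mul_add]
            exact add_le_add h1 le_rfl

/-- **A PRODUCT OF NEAR-IDENTITY FACTORS IS LINEAR TO SECOND ORDER**: `‖Π_i X_i − 1 − Σ_i (X_i − 1)‖ ≤ (1 + a)^ℓ − 1 − ℓ·a` when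
`‖X_i − 1‖ ≤ a`. [folklore] -/
theorem norm_prod_sub_one_sub_sum_le (l : List (Matrix o o ℂ)) {a : ℝ} (ha : 0 ≤ a) (h : ∀ X ∈ l, ‖X - 1‖ ≤ a) :
    ‖l.prod - 1 - (l.map fun X => X - 1).sum‖ ≤ (1 + a) ^ l.length - 1 - l.length * a := by
  induction l with
  | nil => simp
  | cons X l ih =>
    have hX : ‖X - 1‖ ≤ a := h X List.mem_cons_self
    have hl : ∀ Y ∈ l, ‖Y - 1‖ ≤ a := fun Y hY => h Y (List.mem_cons_of_mem X hY)
    have ih' := ih hl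
    have hP : ‖l.prod - 1‖ ≤ (1 + a) ^ l.length - 1 := norm_listProd_sub_one_le l ha hl
    rw [List.prod_cons, List.map_cons, List.sum_cons, List.length_cons]
    have e : X * l.prod - 1 - (X - 1 + (l.map fun X => X - 1).sum)
        = (X - 1) * (l.prod - 1) + (l.prod - 1 - (l.map fun X => X - 1).sum) := by noncomm_ring
    rw [e]
    calc ‖(X - 1) * (l.prod - 1) + (l.prod - 1 - (l.map fun X => X - 1).sum)‖
        ≤ ‖X - 1‖ * ‖l.prod - 1‖ + ‖l.prod - 1 - (l.map fun X => X - 1).sum‖ :=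
          (norm_add_le _ _).trans (add_le_add (Matrix.l2_opNorm_mul _ _) le_rfl)
      _ ≤ a * ((1 + a) ^ l.length - 1) + ((1 + a) ^ l.length - 1 - l.length * a) :=
          add_le_add (mul_le_mul hX hP (norm_nonneg _) ha) ih'
      _ = (1 + a) ^ (l.length + 1) - 1 - ((l.length + 1 : ℕ) : ℝ) * a := by push_cast; ring

/-- **A GROUP OF FINE FACTORS AGAINST ONE COARSE FACTOR**: if `‖X_l − 1‖ ≤ a` and each fine «connection» `X_l − 1` is within `b` of the
`1/ℓ`-th part of the coarse one, `‖(X_l − 1) − ℓ⁻¹(C − 1)‖ ≤ b` (`ℓ = ` the number of fine factors, `ℓ ≥ 1`), then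
`‖Π_l X_l − C‖ ≤ ((1 + a)^ℓ − 1 − ℓa) + ℓb`. [folklore] -/
theorem norm_prod_sub_single_le (l : List (Matrix o o ℂ)) (hl : l ≠ []) (C : Matrix o o ℂ) {a b : ℝ} (ha : 0 ≤ a)
    (h : ∀ X ∈ l, ‖X - 1‖ ≤ a) (hc : ∀ X ∈ l, ‖(X - 1) - ((l.length : ℂ))⁻¹ • (C - 1)‖ ≤ b) :
    ‖l.prod - C‖ ≤ ((1 + a) ^ l.length - 1 - l.length * a) + l.length * b := by
  have hlen : (l.length : ℂ) ≠ 0 := by exact_mod_cast (List.length_pos_of_ne_nil hl).ne'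
  set S := (l.map fun X => X - 1).sum with hS
  have hsum : ∀ (m : List (Matrix o o ℂ)) (D : Matrix o o ℂ),
      (m.map fun X => (X - 1) - D).sum = (m.map fun X => X - 1).sum - (m.length : ℂ) • D := by
    intro m D
    induction m with
    | nil => simp
    | cons X m ih => rw [List.map_cons, List.sum_cons, List.map_cons, List.sum_cons, ih, List.length_cons]; push_cast; module
  have e1 : S - (C - 1) = (l.map fun X => (X - 1) - ((l.length : ℂ))⁻¹ • (C - 1)).sum := by
    rw [hsum, hS, smul_smul, mul_inv_cancel₀ hlen, one_smul]
  have e : l.prod - C = (l.prod - 1 - S) + (S - (C - 1)) := by abel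
  rw [e]
  refine (norm_add_le _ _).trans (add_le_add (norm_prod_sub_one_sub_sum_le l ha h) ?_)
  rw [e1]
  have hns : ∀ m : List (Matrix o o ℂ), ‖m.sum‖ ≤ (m.map fun x => ‖x‖).sum := by
    intro m
    induction m with
    | nil => simp
    | cons x m ih => rw [List.sum_cons, List.map_cons, List.sum_cons]; exact (norm_add_le _ _).trans (add_le_add le_rfl ih)
  refine (hns _).trans ?_
  rw [List.map_map]
  refine (List.sum_le_card_nsmul _ b fun x hx => ?_).trans (le_of_eq ?_)
  · obtain ⟨X, hX, rfl⟩ := List.mem_map.mp hx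
    exact hc X hX
  · rw [List.length_map, nsmul_eq_mul]

end ListAlgebra

/-! ## §2 Legs: concatenation, refinement into groups of `L`, transport of concatenations -/

section Legs

variable (N : ℕ) [NeZero N] (M : Fin d → ℕ) [hM : ∀ μ, NeZero (M μ)]

omit [NeZero N] hM in
/-- `tstep (a + b) = tstep a + tstep b`. [folklore] -/
theorem tstep_add' (ν : Fin d) (a b : ℕ) : tstep (fine N M) ν (a + b) = tstep (fine N M) ν a + tstep (fine N M) ν b := by
  funext κ
  simp only [tstep, Pi.add_apply]
  split_ifs <;> push_cast <;> ring

omit [NeZero N] hM in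
/-- legs concatenate: `leg z (s + s′) = leg z s ++ leg (z + s e_ν) s′`. [folklore] -/
theorem leg_add (ν : Fin d) (z : Tor (fine N M)) (s s' : ℕ) :
    leg N M ν z (s + s') = leg N M ν z s ++ leg N M ν (z + tstep (fine N M) ν s) s' := by
  rw [leg, leg, leg, List.range_add, List.map_append, List.map_map]
  congr 1
  refine List.map_congr_left fun r _ => ?_
  simp only [Function.comp_apply, tstep_add', add_assoc]

omit [NeZero N] hM in
/-- a leg of `L·m` bonds is `m` consecutive groups of `L` bonds. [folklore] -/
theorem leg_mul (L : ℕ) (ν : Fin d) (z : Tor (fine N M)) (m : ℕ) :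
    leg N M ν z (L * m) = (List.range m).flatMap fun i => leg N M ν (z + tstep (fine N M) ν (L * i)) L := by
  induction m with
  | zero => simp [leg]
  | succ m ih => rw [Nat.mul_succ, leg_add, ih, List.range_succ, List.flatMap_append, List.flatMap_singleton]

variable {o : Type*} [Fintype o] [DecidableEq o]

omit [NeZero N] hM in
/-- transport along a concatenation of pieces is the ordered product of the transports. [folklore] -/
theorem transport_flatMap {ι : Type*} (R : Fin d → (Tor (fine N M) × Fin d → Matrix o o ℂ)) (μ : Fin d) (l : List ι)
    (f : ι → List (Tor (fine N M) × Fin d)) :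
    transport (fine N M) R μ (l.flatMap f) = (l.map fun i => transport (fine N M) R μ (f i)).prod := by
  induction l with
  | nil => simp [transport]
  | cons i l ih => rw [List.flatMap_cons, transport_append, ih, List.map_cons, List.prod_cons]

omit [NeZero N] hM in
/-- transport along a leg is the ordered product of its bond variables. [folklore] -/
theorem transport_leg (R : Fin d → (Tor (fine N M) × Fin d → Matrix o o ℂ)) (μ ν : Fin d) (z : Tor (fine N M)) (s : ℕ) :
    transport (fine N M) R μ (leg N M ν z s) = ((List.range s).map fun r => R ν (z + tstep (fine N M) ν r, μ)).prod := by
  rw [transport, leg, List.map_map]; rfl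

omit [NeZero N] hM in
/-- norm of a leg transporter: `≤ (1 + a)^s`. [folklore] -/
theorem norm_transport_leg_le {R : Fin d → (Tor (fine N M) × Fin d → Matrix o o ℂ)} {a : ℝ} (ha : 0 ≤ a)
    (hR : ∀ ν i, ‖R ν i - 1‖ ≤ a) (μ ν : Fin d) (z : Tor (fine N M)) (s : ℕ) :
    ‖transport (fine N M) R μ (leg N M ν z s)‖ ≤ (1 + a) ^ s := by
  have h := norm_transport_sub_one_le (fine N M) ha hR μ (Γ := leg N M ν z s) (le_refl _)
  rw [length_leg] at h
  have := norm_le_one_add h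
  linarith

end Legs

/-! ## §3 Two levels `n ← L·n`: a refined leg against its parent leg -/

section TwoLevel

variable (n L : ℕ) [NeZero n] [NeZero L] (M : Fin d → ℕ) [hM : ∀ μ, NeZero (M μ)] {o : Type*} [Fintype o] [DecidableEq o]

/-- the per-group defect `γ = ((1 + a′)^L − 1 − La′) + Lb` (second order in the fine size + the group consistency). [folklore] -/
def gam (L : ℕ) (a' b : ℝ) : ℝ := ((1 + a') ^ L - 1 - L * a') + L * b

/-- the common norm bound of all factors `Bc = (1 + a′)^L·(1 + a)`. [folklore] -/
def Bc (L : ℕ) (a' a : ℝ) : ℝ := (1 + a') ^ L * (1 + a)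

omit [NeZero n] [NeZero L] hM [Fintype o] [DecidableEq o] in
/-- `Bc ≥ 1`. [folklore] -/
theorem one_le_Bc {a' a : ℝ} (ha' : 0 ≤ a') (ha : 0 ≤ a) : 1 ≤ Bc L a' a :=
  one_le_mul_of_one_le_of_one_le (one_le_pow₀ (by linarith)) (by linarith)

omit [NeZero n] [NeZero L] hM [Fintype o] [DecidableEq o] in
/-- `γ ≥ 0` (Bernoulli). [folklore] -/
theorem gam_nonneg {a' b : ℝ} (ha' : 0 ≤ a') (hb : 0 ≤ b) : 0 ≤ gam L a' b := by
  unfold gam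
  have h : 1 + (L : ℝ) * a' ≤ (1 + a') ^ L := by
    have := one_add_mul_le_pow (show (-2 : ℝ) ≤ a' by linarith) L
    linarith
  have : 0 ≤ (L : ℝ) * b := by positivity
  linarith

omit [NeZero n] hM in
/-- **A REFINED LEG AGAINST ITS PARENT LEG** (phase-aligned: the parent of the `s`-th fine bond is the `⌊s/L⌋`-th coarse bond): with
fine size `a′`, coarse size `a`, per-bond connection consistency `b`, a fine leg of `L·m + e` bonds (`e ≤ L` trailing bonds beyond the
last complete group) and the coarse leg of `m` bonds have transporters within `Bc^{m+1}·(m·γ + ((1 + a′)^L − 1))`. [folklore] -/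
theorem leg_two_level {R' : Fin d → (Tor (fine (L * n) M) × Fin d → Matrix o o ℂ)} {R : Fin d → (Tor (fine n M) × Fin d → Matrix o o ℂ)}
    {a' a b : ℝ} (ha' : 0 ≤ a') (ha : 0 ≤ a)
    (hR' : ∀ ν i, ‖R' ν i - 1‖ ≤ a') (hR : ∀ ν i, ‖R ν i - 1‖ ≤ a)
    (hC : ∀ ν (x' : Tor (fine (L * n) M)) (κ : Fin d), ‖(R' ν (x', κ) - 1) - ((L : ℂ))⁻¹ • (R ν (par n L M x', κ) - 1)‖ ≤ b)
    (ν μ : Fin d) (z' : Tor (fine (L * n) M)) (z : Tor (fine n M))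
    (hpar : ∀ s : ℕ, par n L M (z' + tstep (fine (L * n) M) ν s) = z + tstep (fine n M) ν (s / L))
    (m e : ℕ) (he : e ≤ L) :
    ‖transport (fine (L * n) M) R' μ (leg (L * n) M ν z' (L * m + e)) - transport (fine n M) R μ (leg n M ν z m)‖
      ≤ Bc L a' a ^ (m + 1) * (m * gam L a' b + ((1 + a') ^ L - 1)) := by
  have hL : 0 < L := Nat.pos_of_ne_zero (NeZero.ne L)
  have hBc := one_le_Bc (L := L) ha' ha
  have h1a' : 1 ≤ (1 + a') := by linarith
  -- the fine leg as groups ++ extras, the coarse leg padded by `1`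
  set G : ℕ → Matrix o o ℂ := fun i => transport (fine (L * n) M) R' μ (leg (L * n) M ν (z' + tstep (fine (L * n) M) ν (L * i)) L)
    with hG
  set X : Matrix o o ℂ := transport (fine (L * n) M) R' μ (leg (L * n) M ν (z' + tstep (fine (L * n) M) ν (L * m)) e) with hX
  set C : ℕ → Matrix o o ℂ := fun i => R ν (z + tstep (fine n M) ν i, μ) with hCdef
  have eF : transport (fine (L * n) M) R' μ (leg (L * n) M ν z' (L * m + e)) = ((List.range m).map G ++ [X]).prod := by
    rw [leg_add, transport_append, leg_mul, transport_flatMap, List.prod_append, List.prod_singleton]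
  have eC : transport (fine n M) R μ (leg n M ν z m) = ((List.range m).map C ++ [1]).prod := by
    rw [transport_leg, List.prod_append, List.prod_singleton, Matrix.mul_one]
  rw [eF, eC]
  -- norms of all factors
  have hGn : ∀ i, ‖G i‖ ≤ Bc L a' a := fun i =>
    (norm_transport_leg_le (L * n) M ha' hR' μ ν _ L).trans (le_mul_of_one_le_right (pow_nonneg (by linarith) _) (by linarith))
  have hXn : ‖X‖ ≤ Bc L a' a :=
    ((norm_transport_leg_le (L * n) M ha' hR' μ ν _ e).trans (pow_le_pow_right₀ h1a' he)).trans
      (le_mul_of_one_le_right (pow_nonneg (by linarith) _) (by linarith))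
  have hCn : ∀ i, ‖C i‖ ≤ Bc L a' a := fun i =>
    (norm_le_one_add (hR ν _)).trans (le_mul_of_one_le_left (by linarith) (one_le_pow₀ h1a'))
  have h1n : ‖(1 : Matrix o o ℂ)‖ ≤ Bc L a' a := opNorm_one_le'.trans hBc
  -- per-group defect
  have hGC : ∀ i, ‖G i - C i‖ ≤ gam L a' b := by
    intro i
    simp only [hG]
    rw [transport_leg]
    set lst := (List.range L).map fun r => R' ν (z' + tstep (fine (L * n) M) ν (L * i) + tstep (fine (L * n) M) ν r, μ) with hlst
    have hlen : lst.length = L := by rw [hlst, List.length_map, List.length_range]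
    have hne : lst ≠ [] := by rw [← List.length_pos_iff_ne_nil, hlen]; exact hL
    have h1 : ∀ Y ∈ lst, ‖Y - 1‖ ≤ a' := fun Y hY => by
      obtain ⟨r, _, rfl⟩ := List.mem_map.mp hY; exact hR' _ _
    have h2 : ∀ Y ∈ lst, ‖(Y - 1) - ((lst.length : ℂ))⁻¹ • (C i - 1)‖ ≤ b := fun Y hY => by
      obtain ⟨r, hr, rfl⟩ := List.mem_map.mp hY
      rw [hlen]
      have hrL : r < L := List.mem_range.mp hr
      have hp : par n L M (z' + tstep (fine (L * n) M) ν (L * i) + tstep (fine (L * n) M) ν r) = z + tstep (fine n M) ν i := by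
        rw [add_assoc, ← tstep_add', hpar, Nat.mul_add_div hL, Nat.div_eq_of_lt hrL, add_zero]
      have := hC ν (z' + tstep (fine (L * n) M) ν (L * i) + tstep (fine (L * n) M) ν r) μ
      rwa [hp] at this
    have h3 := norm_prod_sub_single_le lst hne (C i) ha' h1 h2
    rw [hlen] at h3
    exact h3
  -- telescoping
  have hlen : ((List.range m).map G ++ [X]).length = ((List.range m).map C ++ [1]).length := by simp
  refine (norm_prod_sub_prod_le _ _ hlen hBc (fun Y hY => ?_) (fun Y hY => ?_)).trans ?_
  · rcases List.mem_append.mp hY with hY | hY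
    · obtain ⟨i, _, rfl⟩ := List.mem_map.mp hY; exact hGn i
    · rw [List.mem_singleton] at hY; rw [hY]; exact hXn
  · rcases List.mem_append.mp hY with hY | hY
    · obtain ⟨i, _, rfl⟩ := List.mem_map.mp hY; exact hCn i
    · rw [List.mem_singleton] at hY; rw [hY]; exact h1n
  have hlenF : ((List.range m).map G ++ [X]).length = m + 1 := by simp
  rw [hlenF]
  refine mul_le_mul_of_nonneg_left ?_ (pow_nonneg (zero_le_one.trans hBc) _)
  have hzip : ∀ (l : List ℕ), (List.zipWith (fun A B => ‖A - B‖) (l.map G ++ [X]) (l.map C ++ [1])).sum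
      = (l.map fun i => ‖G i - C i‖).sum + ‖X - 1‖ := by
    intro l; induction l with
    | nil => simp
    | cons i l ih =>
      rw [List.map_cons, List.map_cons, List.cons_append, List.cons_append, List.zipWith_cons_cons, List.sum_cons, ih,
        List.map_cons, List.sum_cons, add_assoc]
  rw [hzip]
  have hs1 : ((List.range m).map fun i => ‖G i - C i‖).sum ≤ m * gam L a' b := by
    have h3 := List.sum_le_card_nsmul ((List.range m).map fun i => ‖G i - C i‖) (gam L a' b) (fun x hx => by
      obtain ⟨i, _, rfl⟩ := List.mem_map.mp hx; exact hGC i)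
    rw [List.length_map, List.length_range, nsmul_eq_mul] at h3; exact h3
  have hs2 : ‖X - 1‖ ≤ (1 + a') ^ L - 1 := by
    have h := norm_transport_sub_one_le (fine (L * n) M) ha' hR' μ
      (Γ := leg (L * n) M ν (z' + tstep (fine (L * n) M) ν (L * m)) e) (le_refl _)
    rw [length_leg] at h
    exact h.trans (pow_sub_one_mono ha' he)
  linarith

end TwoLevel

end Summit.QuantumFields.BalabanUV.T4Continuum.NestedContourTransport

end
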